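import Summits.RiemannHypothesis.RiemannHypothesis.Theorems.Splittings.LiSlowRecurrence
import HarnessLib

/-!
# Splittings — Li neg lens: the Li criterion on PRIMES / SQUAREFREE / SQUARES / `m² + 1`, modulo classical recurrence theorems
# in print (SPLIT-li-neg gen 3, §6; zero-definition raw form — the print facts as explicit hypotheses)

Cell rh-split, seat rh-split-li-neg g3 (brief sha16 f79c5f09d8bcb036), card `run/shared/lean/pub/rh-split/cards/SPLIT-li-neg.md`
§9 (gen-3 addendum; referee rh-split-ref g2 2026-08-27T01:27:02Z: DELIVERABLE, farm rc 0 / 0 warn / 0 sorry, std axioms on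
`not_multisetLiCriterionOnAbove_geom` / `riemannHypothesis_iff_liPosOn_of_bohrShift_le_200`, «CONTENT PASS in advance for a
zero-def (or def-spelled) carve of e8ec9abfbb5d6735»); source `HOME/rh-split-li-neg/LiSlowRecurrence.lean` sha16 e8ec9abfbb5d6735,
whose §§1–5 are the LANDED `Theorems/Splittings/LiSlowRecurrence.lean` (p489464, typer-1 g3; `IsSlowRecurrent` / `IsBohrRecurrentShift`
spelled out there).  Filed by rh-split-typer-1 g4.
This part (zero-def): the scratch's §6.  Its three NAMED PRINT FACTS — `ShiftedPrimesBohrRecurrent` «`{p − 1}` is a set of Bohr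
recurrence» [Sárközy 1978 (III); Kamae–Mendès France 1978: `p ± 1` are van der Corput ⇒ intersective ⇒ Bohr-recurrent],
`PrimesPlusOneBohrRecurrent` «`{p + 1}`» [Kamae–Mendès France 1978], `SquaresBohrRecurrent` «the squares» [Weyl 1916; Furstenberg
1981 Thm 3.16; Sárközy 1978 (I)] (locators on the card §9.5, referee-checked) — are NOT asserted and NOT filed as Literature facts
here: each appears SPELLED OUT (the scratch's `IsBohrRecurrentShift S c` body, as in the landed `LiSlowRecurrence.lean`) as an
explicit HYPOTHESIS of the criterion it feeds.  Referee labels (01:27:02Z): (1) «RH ⟺ λ_p ≥ 0 for every prime p» (and squarefree,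
any `T ⊇` primes): RH-EQUIVALENT · CONDITIONAL on a named RH-free PRINT THEOREM · FIN(101) load-bearing (multiset version false,
tree `not_multisetLiCriterionOn_primes`); (2) squares: RH-EQUIVALENT mod the print fact, FIN-free; `m² + 1`: same fact, FIN(101)
load-bearing (`q = 3` multiset refutation, kernel, `not_multisetLiCriterionOn_sq_add_one` below).
Theorems: `riemannHypothesis_iff_liPosOn_primes_of`, `riemannHypothesis_iff_keiperLiCoeff_prime_nonneg_of` (RAW: `RH ⟺ ∀ p prime,
0 ≤ λ_p`), `riemannHypothesis_iff_liPosOn_primes_of'` (from `{p + 1}`), `riemannHypothesis_iff_liPosOn_of_primes_subset_of`,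
`riemannHypothesis_iff_liPosOn_squarefree_of`, `riemannHypothesis_iff_liPosOn_squares_of`, `riemannHypothesis_iff_liPosOn_sq_add_one_of`,
`not_multisetLiCriterionOn_sq_add_one`.  Proof edits vs the scratch: dot-notation ↦ the landed flattened lemmas (`bohrShift_mono`,
`bohrShift_image_add`, `isLiRecurrent_of_bohrShift`).
HONEST LABEL: «SPLITTING SEARCH over kernel-typed RH-EQUIVALENCES; a splitting A ∧ B ⟹ RH is CONDITIONAL bookkeeping
unless A and B are both proved; nothing here bears on the truth of RH.»
-/

set_option linter.dupNamespace false

noncomputable section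

open Complex Filter Topology Set
open scoped ComplexConjugate Real

namespace Summit.RiemannHypothesis.RiemannHypothesis.Theorems.Splittings.LiSlowRecurrence

open Literature.NumberTheory.LFunctions
open Literature.NumberTheory.LFunctions.BombieriLagarias
open Literature.NumberTheory.DiophantineGeometry (RiemannHypothesisUpTo)
open Summit.RiemannHypothesis.RiemannHypothesis.Theorems.Splittings
open Summit.RiemannHypothesis.RiemannHypothesis.Theorems.Splittings.LiIndexSets

/-! ## §6 The Li criteria on primes / squares / shifted squares, modulo classical recurrence facts (as hypotheses) -/

/-- **RH ⟺ λ_p ≥ 0 for every prime p**, modulo the print fact «`{p − 1 : p prime}` is a set of Bohr recurrence» [Sárközy 1978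
(III); Kamae–Mendès France 1978] taken as the HYPOTHESIS `h` (spelled out; not in the tree) — uses the zeros to height 101: the
multiset-level criterion on the primes is FALSE, tree `not_multisetLiCriterionOn_primes`. -/
theorem riemannHypothesis_iff_liPosOn_primes_of
    (h : (∀ (k : ℕ) (z : Fin k → ℂ), (∀ i, ‖z i‖ = 1) → ∀ ε : ℝ, 0 < ε →
      ∀ N : ℕ, ∃ n ∈ {p : ℕ | p.Prime}, N ≤ n ∧ ∀ i, ‖z i ^ ((n : ℤ) - 1) - 1‖ < ε)) :
    _root_.RiemannHypothesis ↔ LiPosOn {p : ℕ | p.Prime} :=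
  riemannHypothesis_iff_liPosOn_of_bohrShift_le_20 h (by norm_num)

/-- RAW form: `RH ⟺ ∀ p prime, 0 ≤ λ_p` (modulo the same hypothesis). -/
theorem riemannHypothesis_iff_keiperLiCoeff_prime_nonneg_of
    (h : (∀ (k : ℕ) (z : Fin k → ℂ), (∀ i, ‖z i‖ = 1) → ∀ ε : ℝ, 0 < ε →
      ∀ N : ℕ, ∃ n ∈ {p : ℕ | p.Prime}, N ≤ n ∧ ∀ i, ‖z i ^ ((n : ℤ) - 1) - 1‖ < ε)) :
    _root_.RiemannHypothesis ↔ ∀ p : ℕ, p.Prime → 0 ≤ keiperLiCoeff p :=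
  (riemannHypothesis_iff_liPosOn_primes_of h).trans
    ⟨fun hS p hp ↦ hS p hp hp.one_lt.le, fun hP p hp _ ↦ hP p hp⟩

/-- Same from the print fact «`{p + 1 : p prime}` is a set of Bohr recurrence» [Kamae–Mendès France 1978], as hypothesis. -/
theorem riemannHypothesis_iff_liPosOn_primes_of'
    (h : (∀ (k : ℕ) (z : Fin k → ℂ), (∀ i, ‖z i‖ = 1) → ∀ ε : ℝ, 0 < ε →
      ∀ N : ℕ, ∃ n ∈ {p : ℕ | p.Prime}, N ≤ n ∧ ∀ i, ‖z i ^ ((n : ℤ) - (-1)) - 1‖ < ε)) :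
    _root_.RiemannHypothesis ↔ LiPosOn {p : ℕ | p.Prime} :=
  riemannHypothesis_iff_liPosOn_of_bohrShift_le_20 h (by norm_num)

/-- Any SUPERSET of the primes inherits the criterion (modulo the hypothesis): e.g. the squarefree numbers (which miss `4ℕ`, so
the multiset-level criterion is FALSE there too, tree `not_multisetLiCriterionOn_of_forall_not_dvd`). -/
theorem riemannHypothesis_iff_liPosOn_of_primes_subset_of
    (h : (∀ (k : ℕ) (z : Fin k → ℂ), (∀ i, ‖z i‖ = 1) → ∀ ε : ℝ, 0 < ε →
      ∀ N : ℕ, ∃ n ∈ {p : ℕ | p.Prime}, N ≤ n ∧ ∀ i, ‖z i ^ ((n : ℤ) - 1) - 1‖ < ε))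
    {T : Set ℕ} (hT : {p : ℕ | p.Prime} ⊆ T) : _root_.RiemannHypothesis ↔ LiPosOn T :=
  riemannHypothesis_iff_liPosOn_of_bohrShift_le_20 (bohrShift_mono h hT) (by norm_num)

/-- **RH ⟺ λ_n ≥ 0 for every squarefree n** (modulo the `{p − 1}` hypothesis; uses the zeros to height 101). -/
theorem riemannHypothesis_iff_liPosOn_squarefree_of
    (h : (∀ (k : ℕ) (z : Fin k → ℂ), (∀ i, ‖z i‖ = 1) → ∀ ε : ℝ, 0 < ε →
      ∀ N : ℕ, ∃ n ∈ {p : ℕ | p.Prime}, N ≤ n ∧ ∀ i, ‖z i ^ ((n : ℤ) - 1) - 1‖ < ε)) :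
    _root_.RiemannHypothesis ↔ LiPosOn {n : ℕ | Squarefree n} :=
  riemannHypothesis_iff_liPosOn_of_primes_subset_of h fun _ hp ↦ (Nat.Prime.prime hp).squarefree

/-- **RH ⟺ λ_{m²} ≥ 0 for every m** — F1-FREE and height-free, modulo the print fact «the squares are a set of Bohr recurrence»
[Weyl 1916; Furstenberg 1981 Thm 3.16; Sárközy 1978 (I)] as the hypothesis `h` (spelled out, shift `0`): the squares are then fully
Li-recurrent, so the multiset-level tree criterion `riemannHypothesis_iff_liPosOn` applies. -/
theorem riemannHypothesis_iff_liPosOn_squares_of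
    (h : (∀ (k : ℕ) (z : Fin k → ℂ), (∀ i, ‖z i‖ = 1) → ∀ ε : ℝ, 0 < ε →
      ∀ N : ℕ, ∃ n ∈ {n : ℕ | ∃ m, n = m ^ 2}, N ≤ n ∧ ∀ i, ‖z i ^ ((n : ℤ) - 0) - 1‖ < ε)) :
    _root_.RiemannHypothesis ↔ LiPosOn {n : ℕ | ∃ m, n = m ^ 2} :=
  riemannHypothesis_iff_liPosOn (isLiRecurrent_of_bohrShift h)

/-- **RH ⟺ λ_{m²+1} ≥ 0 for every m** (modulo the squares hypothesis; USES the zeros to height 101 — `{m² + 1}` misses every multiple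
of 3, so the multiset-level criterion fails there, `not_multisetLiCriterionOn_sq_add_one`). -/
theorem riemannHypothesis_iff_liPosOn_sq_add_one_of
    (h : (∀ (k : ℕ) (z : Fin k → ℂ), (∀ i, ‖z i‖ = 1) → ∀ ε : ℝ, 0 < ε →
      ∀ N : ℕ, ∃ n ∈ {n : ℕ | ∃ m, n = m ^ 2}, N ≤ n ∧ ∀ i, ‖z i ^ ((n : ℤ) - 0) - 1‖ < ε)) :
    _root_.RiemannHypothesis ↔ LiPosOn {n : ℕ | ∃ m, n = m ^ 2 + 1} := by
  have h1 : (∀ (k : ℕ) (z : Fin k → ℂ), (∀ i, ‖z i‖ = 1) → ∀ ε : ℝ, 0 < ε →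
      ∀ N : ℕ, ∃ n ∈ ((· + 1) '' {n : ℕ | ∃ m, n = m ^ 2}), N ≤ n ∧ ∀ i, ‖z i ^ ((n : ℤ) - (0 + 1)) - 1‖ < ε) := bohrShift_image_add h 1
  have hset : ((· + 1) '' {n : ℕ | ∃ m, n = m ^ 2}) = {n : ℕ | ∃ m, n = m ^ 2 + 1} := by
    ext n
    constructor
    · rintro ⟨k, ⟨m, rfl⟩, rfl⟩; exact ⟨m, rfl⟩
    · rintro ⟨m, rfl⟩; exact ⟨m ^ 2, ⟨m, rfl⟩, rfl⟩
  rw [hset, zero_add] at h1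
  exact riemannHypothesis_iff_liPosOn_of_bohrShift_le_20 h1 (by norm_num)

/-- The multiset-level criterion on `{m² + 1}` is FALSE (misses `3ℕ`). -/
theorem not_multisetLiCriterionOn_sq_add_one : ¬ MultisetLiCriterionOn {n : ℕ | ∃ m, n = m ^ 2 + 1} :=
  not_multisetLiCriterionOn_of_forall_not_dvd (q := 3) (by norm_num) fun n hn _ h3 ↦ by
    obtain ⟨m, rfl⟩ := hn
    have h9 : m ^ 2 % 3 = 0 ∨ m ^ 2 % 3 = 1 := by
      have : m % 3 = 0 ∨ m % 3 = 1 ∨ m % 3 = 2 := by omega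
      rcases this with h | h | h <;> simp [pow_two, Nat.mul_mod, h]
    omega

end Summit.RiemannHypothesis.RiemannHypothesis.Theorems.Splittings.LiSlowRecurrence

end
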